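import Summits.FinalStateConjecture.FinalStateConjecture.Theorems.SeamedChartsExhaust.Negative.ReversedFlatChart

/-!
# `HonestCore` (d) is load-bearing for `FutureOrientedOfSeamed`
# (negative-side support for crux `stmt-FinalStateConjecture-17576`, route `StarvedNecks`)

The crux `FutureOrientedOfSeamed` (`Theses/StarvedNecks.lean`, item stmt-FinalStateConjecture-17576) asserts,
for every `C²` final-state decomposition `d` of the self-determined exterior `O = J⁺(ι X) ∩ I⁻(d.charted)` of an
MGHD, that `HonestCore(d, R₀)` (clauses (a)–(d)) and `SEAMED(d, R, R₀)` (clauses (1)–(12)) imply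
`Summit.FinalStateConjecture.IsFutureOriented d` = (i) orthochronous motions ∧ (ii) future-directed push-forwards
`dΨᵢ(ΛᵢV)` on late truncated hole slabs ∧ (iii) future-directed `dΦ(∂₀)` on late flat slabs.

Load-bearing analysis, clause (iii). Conjunct (iii) is `HonestCore` (d) restricted to the slabs `{x⁰ = τ}`,
`τ > τ₀`, and NOTHING ELSE among the seventeen hypotheses speaks about the time direction of the flat chart:
`not_forall_isFutureOriented_without_flatOrientation` shows that with `HonestCore` (a)–(c) and ALL twelve SEAMED
clauses kept verbatim, and `O = J⁺(Σ) ∩ I⁻(d.charted)` for an arbitrary set `Σ` (the spacetime-level form used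
by the sibling negative lemma `SeamedChartsExhaust.Negative.not_forall_hasExhaustiveCharts_without_futureOrientation`),
the conclusion fails for the time-reversed flat chart on Minkowski spacetime (`ReversedModel.decomp` of
`SeamedChartsExhaust/Negative/ReversedFlatChart.lean`: `Σ = ℝ⁴`, `O = {x⁰ < 0}`, `N = 0`, flat chart
`x ↦ (−x⁰, x̲)` after `τ₀ = 0`; an exact anti-chronous isometry of `η`, so every deviation vanishes and every
SEAMED clause holds, while `dΦ(∂₀) = −∂₀` is past-directed on every flat slab: `not_isFutureOriented_reversedDecomp`).

Scope note. With `N = 0` the conjuncts (i), (ii) are vacuous, so the witness isolates (iii) ⇐ (d); the hole-chart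
conjunct (ii) is anchored redundantly (SEAMED (5); or ONE ATLAS (6) + (d); or, in a causally well-behaved
development, the anchoring clause (b)), see the crux work file `Cruxes/FutureOrientedOfSeamed/Disproof.lean`.
Everything is `sorry`-free; no named fact is introduced (the dropped-clause statement is inlined).

References: B. O'Neill, *Semi-Riemannian geometry*, Academic Press 1983, Ch. 5, p. 145 (time cones,
future/past-directed vectors); M. Dafermos, G. Holzegel, I. Rodnianski, M. Taylor, arXiv:2104.08222, §1
(late-time charts; `FinalStateDecomposition` in the tree).
-/

noncomputable section

open TopologicalSpace Manifold Filter Topology Set Function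
open scoped ContDiff Topology ENNReal Manifold

-- `<Problem> = <Summit>` doubles the namespace component (tree-wide convention, cf. lakefile)
set_option linter.dupNamespace false

namespace Summit.FinalStateConjecture.FinalStateConjecture.Theorems.FutureOrientedOfSeamed.Negative

open Literature.Geometry.Lorentzian LorentzianMetric
open Summit.FinalStateConjecture.FinalStateConjecture.Theorems.SeamedChartsExhaust.Negative

/-- The time-reversed flat chart on Minkowski spacetime is NOT future-oriented: on every flat slab `{x⁰ = τ}`
the push-forward `dΦ(∂₀) = −∂₀` is past-directed (`η(∂₀, −∂₀) = 1 > 0`), so conjunct (iii) of `IsFutureOriented`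
fails (tested at the slab point `τ ∂₀`). O'Neill 1983, Ch. 5, p. 145. [folklore] -/
theorem not_isFutureOriented_reversedDecomp : ¬ IsFutureOriented ReversedModel.decomp := by
  rintro ⟨-, -, h3⟩
  obtain ⟨τ, hτ⟩ := h3.exists
  have hx : (⟨τ • E4.basisVector 0, trivial⟩ : (⊤ : Opens E4)) ∈ (Minkowski.backgroundOn ⊤).timeSlab τ := by
    show (τ • E4.basisVector 0 : E4) 0 = τ
    simp
  have h := (hτ ⟨τ • E4.basisVector 0, trivial⟩ hx).2
  change Minkowski.bilin (E4.basisVector 0)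
    (mfderiv 𝓘(ℝ, E4) (𝓡 4) ReversedModel.Φ ⟨τ • E4.basisVector 0, trivial⟩ (E4.basisVector 0)) < 0 at h
  rw [ReversedModel.mfderiv_Φ_apply, Minkowski.bilin_basisVector_zero_left, ReversedModel.T_apply_zero] at h
  simp at h
  linarith

/-- **`HonestCore` (d) is load-bearing for `FutureOrientedOfSeamed`.** The spacetime-level form of
`StarvedNecks.FutureOrientedOfSeamed` with the future-orientation clause (d) of the flat chart DELETED —
hypotheses, in order: the shape `O = J⁺(Σ) ∩ I⁻(d.charted)`; `HonestCore` (a) sub-extremal holes, `100 Mᵢ ≤ R₀`,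
orthochronous boosts; (b) anchoring; (c) relative closedness; SEAMED (1)–(12) verbatim — does NOT imply
`IsFutureOriented d`: the time-reversed flat chart on Minkowski spacetime (`ReversedModel.decomp`, `N = 0`)
satisfies all of them and its `dΦ(∂₀)` is past-directed on every flat slab. O'Neill 1983, Ch. 5, p. 145. [folklore] -/
theorem not_forall_isFutureOriented_without_flatOrientation :
    ¬ ∀ (𝓢 : Spacetime.{0} 4) (S₀ O : Set 𝓢.carrier) (d : FinalStateDecomposition 𝓢 O 2)
        (R : Fin d.N → ℝ → ℝ) (R₀ : ℝ),
      O = 𝓢.metric.causalFuture 𝓢.timeOrientation S₀ ∩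
        𝓢.metric.chronologicalPast 𝓢.timeOrientation d.charted →
      -- HonestCore (a)
      (∀ i, Kerr.IsSubextremal (d.mass i) (d.spin i) ∧ 100 * d.mass i ≤ R₀ ∧
        0 < ((d.motion i).1 : E4 ≃L[ℝ] E4) (E4.basisVector 0) 0) →
      -- HonestCore (b): anchoring
      (∀ i (ϱ τ₂ : ℝ), R₀ ≤ ϱ → d.τ₀ < τ₂ →
        d.chart i '' {x | d.τ₀ < (d.background i).time x.1 ∧ (d.background i).time x.1 < τ₂ ∧
            (d.background i).radius x.1 < ϱ} ⊆
          𝓢.metric.causalPast 𝓢.timeOrientation (d.chart i '' (d.background i).truncTimeSlab ϱ τ₂)) →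
      -- HonestCore (c): relative closedness
      (∀ i (τ' : ℝ) (ϱ : ℝ → ℝ), Continuous ϱ → d.τ₀ < τ' →
        closure (d.chart i '' {x | τ' ≤ (d.background i).time x.1 ∧
            (d.background i).radius x.1 ≤ ϱ ((d.background i).time x.1)}) ∩ O ⊆
          d.chart i '' {x | τ' ≤ (d.background i).time x.1 ∧
            (d.background i).radius x.1 ≤ ϱ ((d.background i).time x.1)}) →
      -- SEAMED (1)
      (∀ i, Monotone (R i) ∧ Continuous (R i) ∧ ∀ s, R₀ + 4 ≤ R i s ∧ R₀ ≤ d.excision i s) →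
      -- SEAMED (2)
      (∀ i, Tendsto (fun τ ↦ 𝓢.truncDeviationCk (d.background i) (d.chart i) 2 (R i τ) τ) atTop (𝓝 0)) →
      -- SEAMED (3)
      supCkENorm (Subtype.val '' {y : d.flatDomain | d.τ₀ ≤ y.1 0}) 0
          (𝓢.deviationExtend (Minkowski.backgroundOn d.flatDomain) d.flatChart) ≤ 10⁻¹ →
      -- SEAMED (4)
      (∀ i, supCkENorm (Subtype.val '' {x : (d.background i).domain |
          (d.τ₀ ≤ (d.background i).time x.1 ∨ d.τ₀ ≤ x.1 0) ∧ R₀ ≤ (d.background i).radius x.1 ∧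
            (d.background i).radius x.1 ≤ R i ((d.background i).time x.1)}) 0
          (𝓢.deviationExtend (d.background i) (d.chart i)) ≤
          ENNReal.ofReal (1 / (10 * ‖(((d.motion i).1 : E4 ≃L[ℝ] E4) : E4 →L[ℝ] E4)‖ ^ 2))) →
      -- SEAMED (5)
      (∀ i (x : (d.background i).domain), (d.τ₀ ≤ (d.background i).time x.1 ∨ d.τ₀ ≤ x.1 0) →
        R₀ ≤ (d.background i).radius x.1 → (d.background i).radius x.1 ≤ R i ((d.background i).time x.1) →
        𝓢.timeOrientation.IsFutureDirected
          (mfderiv 𝓘(ℝ, E4) (𝓡 4) (d.chart i) x (((d.motion i).1 : E4 ≃L[ℝ] E4) (E4.basisVector 0)))) →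
      -- SEAMED (6): one atlas
      (∀ i (y : E4) (hy : y ∈ (d.background i).domain), d.τ₀ ≤ y 0 →
        (∀ j, d.excision j (y 0) < (d.background j).radius y) →
        (d.background i).radius y ≤ R i ((d.background i).time y) + 1 →
        ∃ hy' : y ∈ d.flatDomain, d.chart i ⟨y, hy⟩ = d.flatChart ⟨y, hy'⟩) →
      -- SEAMED (7)
      (∀ y : d.flatDomain, d.τ₀ ≤ y.1 0 → ∀ j, d.excision j (y.1 0) < (d.background j).radius y.1) →
      -- SEAMED (8)
      (∀ j (y : E4), d.τ₀ ≤ y 0 → (d.background j).radius y ≤ d.excision j (y 0) →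
        (d.background j).radius y + 2 ≤ R j ((d.background j).time y)) →
      -- SEAMED (9)
      (∀ j (y : E4), d.τ₀ ≤ (d.background j).time y →
        (d.background j).radius y ≤ R j ((d.background j).time y) + 2 → (d.background j).time y ≤ y 0) →
      -- SEAMED (10)
      (∀ j, d.chart j '' {x | d.τ₀ < (d.background j).time x.1 ∧
          R j ((d.background j).time x.1) + 1 < (d.background j).radius x.1} ⊆ d.radiationZone) →
      -- SEAMED (11)
      (∀ τ' : ℝ, d.τ₀ < τ' → closure (d.flatChart '' {y | τ' ≤ y.1 0}) ⊆
        d.flatChart '' {y | τ' ≤ y.1 0} ∪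
          ⋃ j, d.chart j '' {x | τ' ≤ x.1 0 ∧ (d.background j).radius x.1 = d.excision j (x.1 0)}) →
      -- SEAMED (12)
      (∀ j j' (y : E4), j ≠ j' → (d.τ₀ ≤ y 0 ∨ d.τ₀ ≤ (d.background j).time y) →
        (d.background j).radius y ≤ R j ((d.background j).time y) + 1 →
        R j' ((d.background j').time y) + 1 < (d.background j').radius y) →
      IsFutureOriented d := by
  intro h
  refine not_isFutureOriented_reversedDecomp
    (h Minkowski.spacetime univ ReversedModel.O ReversedModel.decomp Fin.elim0 0 ReversedModel.O_eq
      (fun i ↦ i.elim0) (fun i ↦ i.elim0) (fun i ↦ i.elim0) (fun i ↦ i.elim0) (fun i ↦ i.elim0) ?_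
      (fun i ↦ i.elim0) (fun i ↦ i.elim0) (fun i ↦ i.elim0) (fun _ _ j ↦ j.elim0) (fun j ↦ j.elim0)
      (fun j ↦ j.elim0) (fun j ↦ j.elim0) ?_ (fun j ↦ j.elim0))
  · show supCkENorm _ 0 (Minkowski.spacetime.deviationExtend (Minkowski.backgroundOn ⊤) ReversedModel.Φ) ≤ 10⁻¹
    rw [ReversedModel.deviationExtend_Φ, supCkENorm_zero]
    exact zero_le
  · intro τ' _ x hx
    have hc : IsClosed {x : E4 | x 0 ≤ -τ'} :=
      isClosed_le (PiLp.continuous_apply 2 _ 0) continuous_const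
    have hx' : x ∈ closure (ReversedModel.Φ '' {y : (⊤ : Opens E4) | τ' ≤ y.1 0} : Set E4) := hx
    rw [ReversedModel.image_Φ_ge, hc.closure_eq] at hx'
    left
    show x ∈ (ReversedModel.Φ '' {y : (⊤ : Opens E4) | τ' ≤ y.1 0} : Set E4)
    rw [ReversedModel.image_Φ_ge]
    exact hx'

end Summit.FinalStateConjecture.FinalStateConjecture.Theorems.FutureOrientedOfSeamed.Negative

end
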